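import Summits.AtomisticToContinuum.HydrodynamicLimit.Theorems.TwoClocksEquilibriumFastWindowLDBirthT12LorentzCircleAvg
import HarnessLib

/-!
# Circle averages of zonal Legendre functions: the product formula `A_z P_ℓ(⟪n', ·⟫) = P_ℓ(z) P_ℓ(⟪n', ·⟫)`
# and Funk–Hecke for Legendre polynomials on `S²`
# (helpers `t12_circleAvg_legendre`, `t12_funkHecke_legendre` of the line `birth`, crux
# `TwoClocks.EquilibriumFastWindowLD`, stmt-AtomisticToContinuum-14440; §6 FF2/FF4-infrastructure towards the
# registered analytic sub-goal `t12_logLinearPreimage_and_dipoleModulus`)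

Plan §6 of the sub-goal writes the far-field gain operator and its iterates in CIRCLE AVERAGES
`(A_z Y)(n) = (2π)⁻¹ ∫_{-π}^{π} Y(z n + √(1-z²)(cos φ e₁ n + sin φ e₂ n)) dφ` (FACT F, `…T12LorentzCircleAvg`; frame
`Lambert.e₁/e₂`) and bounds the `k`-fold iterate on the sector `ℓ ≥ 2` through the Legendre series
`θ_k ≤ Σ_ℓ (2ℓ+1)/2 ‖P_ℓ‖₁ Π_i |P_ℓ(ρ_i)|` (FF4, certified in `…T12LegendreCertificate`). The harmonic-analysis
input that turns iterated circle averages into Legendre numbers is the action of `A_z` on zonal harmonics,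
`A_z P_ℓ(⟪n', ·⟫)(n) = P_ℓ(z) P_ℓ(⟪n, n'⟫)` for EVERY degree `ℓ` and every pole `n'` — classically the `m = 0`
part of the addition theorem for spherical harmonics. This file proves it WITHOUT spherical harmonics, for
the tree's Rodrigues Legendre polynomials `Literature.Analysis.SpecialFunctions.legendre`:

* `intervalIntegral_comp_cos_add_sin` — phase invariance `∫ G(a cos φ + b sin φ) dφ = ∫ G(√(a²+b²) cos φ) dφ`
  over a period; `intervalIntegral_cos_pow_odd` — odd cosine moments vanish;
* `exists_polynomial_circleIntegral` — the circle average `x ↦ ∫ p(x y + √(1-x²)√(1-y²) cos φ) dφ` of a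
  polynomial `p` is a polynomial in `x` of degree `≤ deg p` (binomial expansion);
* `intervalIntegral_mul_circleIntegral_comm` — it is SELF-ADJOINT on `L²[-1, 1]`: both pairings are the
  sphere integral `∫_{S²} g(⟪n, ω⟫) f(⟪n', ω⟫) dσ(ω)` (`⟪n, n'⟫ = y`) in cylindrical coordinates about `n`,
  resp. `n'` (Funk–Hecke for circles `integral_sphere_zonal_mul_eq_intervalIntegral` + Parseval in the frame);
* **`circleIntegral_legendre`** — Legendre's product formula
  `∫_{-π}^{π} P_ℓ(x y + √(1-x²)√(1-y²) cos φ) dφ = 2π P_ℓ(x) P_ℓ(y)`: the image `Q` of `P_ℓ` has degree `≤ ℓ`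
  and is orthogonal to `P_k`, `k < ℓ` (self-adjointness + `integral_legendre_mul_eq_zero`), hence `Q = c P_ℓ`
  (`eq_zero_of_orthogonal_legendre`), and `c = Q(1) = 2π P_ℓ(y)` (degenerate circle at the pole);
* **`circleIntegral_legendre_inner`** (registered `t12_circleAvg_legendre`) — the sphere form
  `∫_{-π}^{π} P_ℓ(⟪n', c_z(φ)⟫) dφ = 2π P_ℓ(z) P_ℓ(⟪n, n'⟫)`, `c_z(φ)` the circle of height `z` about `n`;
* **`integral_sphere_zonal_mul_legendre`** (registered `t12_funkHecke_legendre`) — FUNK–HECKE: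
  `∫_{S²} k(⟪n, ω⟫) P_ℓ(⟪n', ω⟫) dσ(ω) = λ_ℓ(k) P_ℓ(⟪n, n'⟫)`, `λ_ℓ(k) = 2π ∫_{-1}^{1} k P_ℓ`: every zonal operator
  is diagonal on zonal harmonics with its Legendre coefficient as eigenvalue (for the one far-field step,
  `k = (2/π)x₊² a(sx)`, these are the multipliers `λ_ℓ(α) = 4∫₀¹ρ^{α+1}P_ℓ(ρ)dρ` of `…T12Indicial`).

NOT here: the `k`-fold iterates (sibling file `…T12CircleIterate`), completeness / the Legendre SERIES of a
zonal kernel (`Literature…LegendreHilbertBasis`). All statements are [folklore] (Legendre 1785 / Laplace;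
Funk 1916, Hecke 1918).
-/

noncomputable section

open MeasureTheory Real Set Filter Metric Polynomial
open scoped ENNReal BigOperators InnerProductSpace
namespace Summit.AtomisticToContinuum.HydrodynamicLimit.Theorems.ClampedCorrectorBirth

open Literature.Analysis.FluidPDE Literature.MathematicalPhysics.KineticTheory
  Literature.Analysis.SpecialFunctions

/-! ### Circle integrals: phase invariance and odd cosine moments -/

/-- **Phase invariance of circle integrals**:
`∫_{-π}^{π} G(a cos φ + b sin φ) dφ = ∫_{-π}^{π} G(√(a²+b²) cos φ) dφ` — write `(a, b) = R(cos φ₀, sin φ₀)`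
and shift the Haar measure of the circle `ℝ/2πℤ` by `φ₀`. [folklore] -/
theorem intervalIntegral_comp_cos_add_sin (G : ℝ → ℝ) (a b : ℝ) :
    ∫ φ in (-π)..π, G (a * cos φ + b * sin φ) = ∫ φ in (-π)..π, G (√(a ^ 2 + b ^ 2) * cos φ) := by
  set R := √(a ^ 2 + b ^ 2) with hR
  obtain ⟨φ₀, ha, hb⟩ : ∃ φ₀ : ℝ, R * cos φ₀ = a ∧ R * sin φ₀ = b := by
    refine ⟨Complex.arg ⟨a, b⟩, ?_, ?_⟩
    · have h := Complex.norm_mul_cos_arg ⟨a, b⟩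
      rw [Complex.norm_eq_sqrt_sq_add_sq] at h
      exact h
    · have h := Complex.norm_mul_sin_arg ⟨a, b⟩
      rw [Complex.norm_eq_sqrt_sq_add_sq] at h
      exact h
  have h1 : ∀ φ : ℝ, a * cos φ + b * sin φ = R * cos (φ - φ₀) := fun φ => by
    rw [cos_sub, ← ha, ← hb]; ring
  have hper : Function.Periodic (fun ψ : ℝ => G (R * cos ψ)) (2 * π) := fun ψ => by
    simp only [cos_add_two_pi]
  simp_rw [h1]
  rw [intervalIntegral.integral_comp_sub_right (fun ψ => G (R * cos ψ)) φ₀]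
  have h2 := hper.intervalIntegral_add_eq (-π - φ₀) (-π)
  rw [show -π - φ₀ + 2 * π = π - φ₀ by ring, show -π + 2 * π = π by ring] at h2
  exact h2

/-- Odd moments of the cosine over a period vanish: `∫_{-π}^{π} cos^{2k+1} φ dφ = 0` (shift by `π`).
[folklore] -/
theorem intervalIntegral_cos_pow_odd (k : ℕ) : ∫ φ in (-π)..π, cos φ ^ (2 * k + 1) = 0 := by
  have hper : Function.Periodic (fun φ : ℝ => cos φ ^ (2 * k + 1)) (2 * π) := fun φ => by
    simp only [cos_add_two_pi]
  have h1 := hper.intervalIntegral_add_eq (-π) 0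
  rw [show -π + 2 * π = π by ring, zero_add] at h1
  have h2 : ∫ φ in (0:ℝ)..2 * π, cos φ ^ (2 * k + 1) = -∫ φ in (-π)..π, cos φ ^ (2 * k + 1) := by
    have h3 := intervalIntegral.integral_comp_add_right (a := -π) (b := π) (fun φ : ℝ => cos φ ^ (2 * k + 1)) π
    rw [show -π + π = (0:ℝ) by ring, show π + π = 2 * π by ring] at h3
    rw [← h3, ← intervalIntegral.integral_neg]
    refine intervalIntegral.integral_congr fun x _ => ?_
    simp only [cos_add_pi]
    rw [Odd.neg_pow ⟨k, rfl⟩]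
  linarith [h1, h2]

/-! ### The circle average preserves polynomials and their degree -/

/-- The circle integral of a power of `x y + √(1-x²)√(1-y²) cos φ` is a polynomial in `x` of degree at most
the exponent (binomial expansion: odd cosine moments vanish, even ones carry `((1-x²)(1-y²))^j`). [folklore] -/
theorem exists_polynomial_circleIntegral_pow (d : ℕ) {y : ℝ} (hy : y ∈ Icc (-1:ℝ) 1) :
    ∃ Q : ℝ[X], Q.natDegree ≤ d ∧ ∀ x ∈ Icc (-1:ℝ) 1,
      ∫ φ in (-π)..π, (x * y + √(1 - x ^ 2) * √(1 - y ^ 2) * cos φ) ^ d = Q.eval x := by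
  refine ⟨∑ k ∈ Finset.range (d + 1), C ((d.choose k : ℝ) * (∫ φ in (-π)..π, cos φ ^ k) *
      ((1 - y ^ 2) ^ (k / 2) * y ^ (d - k))) * ((1 - X ^ 2) ^ (k / 2) * X ^ (d - k)), ?_, fun x hx => ?_⟩
  · refine natDegree_sum_le_of_forall_le _ _ fun k hk => (natDegree_C_mul_le _ _).trans ?_
    have hk' : k ≤ d := Nat.lt_succ_iff.1 (Finset.mem_range.1 hk)
    have h1 : ((1 - X ^ 2 : ℝ[X]) ^ (k / 2)).natDegree ≤ k / 2 * 2 :=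
      natDegree_pow_le_of_le _ ((natDegree_sub_le _ _).trans (by simp))
    have h2 : ((X : ℝ[X]) ^ (d - k)).natDegree ≤ d - k := natDegree_X_pow_le _
    refine natDegree_mul_le.trans ?_
    have := Nat.div_mul_le_self k 2
    omega
  · have hx2 : 0 ≤ 1 - x ^ 2 := by nlinarith [hx.1, hx.2]
    have hy2 : 0 ≤ 1 - y ^ 2 := by nlinarith [hy.1, hy.2]
    have hexp : ∀ φ : ℝ, (x * y + √(1 - x ^ 2) * √(1 - y ^ 2) * cos φ) ^ d =
        ∑ k ∈ Finset.range (d + 1), (√(1 - x ^ 2) * √(1 - y ^ 2)) ^ k * (x * y) ^ (d - k) *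
          (d.choose k : ℝ) * cos φ ^ k := fun φ => by
      rw [add_comm, add_pow]
      exact Finset.sum_congr rfl fun k _ => by ring
    simp_rw [hexp]
    rw [intervalIntegral.integral_finsetSum (fun k _ => ?_), eval_finsetSum]
    · refine Finset.sum_congr rfl fun k _ => ?_
      rw [intervalIntegral.integral_const_mul]
      simp only [eval_mul, eval_C, eval_pow, eval_sub, eval_one, eval_X]
      obtain ⟨j, rfl | rfl⟩ := Nat.even_or_odd' k
      · have h3 : (√(1 - x ^ 2) * √(1 - y ^ 2)) ^ (2 * j) = ((1 - x ^ 2) * (1 - y ^ 2)) ^ j := by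
          rw [pow_mul, mul_pow (√(1 - x ^ 2)), sq_sqrt hx2, sq_sqrt hy2]
        rw [show 2 * j / 2 = j by omega, h3, mul_pow, mul_pow]
        ring
      · rw [show (2 * j + 1) / 2 = j by omega, intervalIntegral_cos_pow_odd j]
        ring
    · exact (by fun_prop : Continuous fun φ : ℝ => (√(1 - x ^ 2) * √(1 - y ^ 2)) ^ k * (x * y) ^ (d - k) *
        (d.choose k : ℝ) * cos φ ^ k).intervalIntegrable _ _

/-- **The circle average preserves polynomials and their degree**: for `p ∈ ℝ[X]` and `y ∈ [-1, 1]` there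
is `Q ∈ ℝ[X]` with `deg Q ≤ deg p` and `∫_{-π}^{π} p(x y + √(1-x²)√(1-y²) cos φ) dφ = Q(x)` on `[-1, 1]`.
[folklore] -/
theorem exists_polynomial_circleIntegral (p : ℝ[X]) {y : ℝ} (hy : y ∈ Icc (-1:ℝ) 1) :
    ∃ Q : ℝ[X], Q.natDegree ≤ p.natDegree ∧ ∀ x ∈ Icc (-1:ℝ) 1,
      ∫ φ in (-π)..π, p.eval (x * y + √(1 - x ^ 2) * √(1 - y ^ 2) * cos φ) = Q.eval x := by
  choose Q hQd hQe using fun d => exists_polynomial_circleIntegral_pow d hy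
  refine ⟨∑ i ∈ Finset.range (p.natDegree + 1), C (p.coeff i) * Q i, ?_, fun x hx => ?_⟩
  · refine natDegree_sum_le_of_forall_le _ _ fun i hi => (natDegree_C_mul_le _ _).trans ?_
    exact (hQd i).trans (Nat.lt_succ_iff.1 (Finset.mem_range.1 hi))
  · have hev : ∀ w : ℝ, p.eval w = ∑ i ∈ Finset.range (p.natDegree + 1), p.coeff i * w ^ i :=
      fun w => eval_eq_sum_range w
    simp_rw [hev]
    rw [intervalIntegral.integral_finsetSum (fun i _ => ?_), eval_finsetSum]
    · refine Finset.sum_congr rfl fun i _ => ?_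
      rw [intervalIntegral.integral_const_mul, eval_mul, eval_C, hQe i x hx]
    · exact (by fun_prop : Continuous fun φ : ℝ =>
        p.coeff i * (x * y + √(1 - x ^ 2) * √(1 - y ^ 2) * cos φ) ^ i).intervalIntegrable _ _


/-! ### Self-adjointness of the circle average (symmetry of the two poles) -/

/-- A continuous function of the height `⟪n', ·⟫` is bounded on the unit sphere. [folklore] -/
theorem exists_bound_comp_inner_sphere {f : ℝ → ℝ} (hf : Continuous f) {n' : EuclideanSpace ℝ (Fin 3)}
    (hn' : ‖n'‖ = 1) : ∃ C : ℝ, ∀ x : EuclideanSpace ℝ (Fin 3), ‖x‖ = 1 → |f ⟪n', x⟫_ℝ| ≤ C := by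
  obtain ⟨C, hC⟩ := (isCompact_Icc (a := (-1:ℝ)) (b := 1)).exists_bound_of_continuousOn hf.continuousOn
  refine ⟨C, fun x hx => ?_⟩
  have h := abs_real_inner_le_norm n' x
  rw [hn', hx, mul_one] at h
  simpa [Real.norm_eq_abs] using hC _ (abs_le.1 h |> fun h' => ⟨h'.1, h'.2⟩)

/-- **Self-adjointness of the circle average.** For continuous `f, g` and `y ∈ [-1, 1]`:
`∫_{-1}^{1} g(x) ∫_{-π}^{π} f(x y + √(1-x²)√(1-y²) cos φ) dφ dx = ∫_{-1}^{1} f(x) ∫_{-π}^{π} g(x y + √(1-x²)√(1-y²) cos φ) dφ dx`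
— both sides are `∫_{S²} g(⟪n, ω⟫) f(⟪n', ω⟫) dσ(ω)` for two unit vectors at angle `arccos y`, written in
cylindrical coordinates about `n`, resp. about `n'` (`integral_sphere_zonal_mul_eq_intervalIntegral`,
phase invariance `intervalIntegral_comp_cos_add_sin`, Parseval in the frame `(e₁ n', e₂ n', n')`). [folklore] -/
theorem intervalIntegral_mul_circleIntegral_comm {f g : ℝ → ℝ} (hf : Continuous f) (hg : Continuous g)
    {y : ℝ} (hy : y ∈ Icc (-1:ℝ) 1) :
    ∫ x in (-1:ℝ)..1, g x * ∫ φ in (-π)..π, f (x * y + √(1 - x ^ 2) * √(1 - y ^ 2) * cos φ) =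
      ∫ x in (-1:ℝ)..1, f x * ∫ φ in (-π)..π, g (x * y + √(1 - x ^ 2) * √(1 - y ^ 2) * cos φ) := by
  have hy2 : 0 ≤ 1 - y ^ 2 := by nlinarith [hy.1, hy.2]
  -- the two poles
  set n : EuclideanSpace ℝ (Fin 3) := EuclideanSpace.single 0 1 with hn_def
  have hn : ‖n‖ = 1 := by rw [hn_def]; simp
  set n' : EuclideanSpace ℝ (Fin 3) := y • n + √(1 - y ^ 2) • Lambert.e₁ n with hn'_def
  have hn' : ‖n'‖ = 1 := by
    have h := norm_cylPoint hn (z := y) (by nlinarith [hy.1, hy.2]) 0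
    rwa [cos_zero, sin_zero, one_smul, zero_smul, add_zero] at h
  have hnn' : ⟪n, n'⟫_ℝ = y := by
    rw [hn'_def, inner_add_right, inner_smul_right, inner_smul_right, real_inner_self_eq_norm_sq, hn,
      Lambert.inner_self_e₁]
    ring
  -- the sphere integral, about `n`
  obtain ⟨Cf, hCf⟩ := exists_bound_comp_inner_sphere hf hn'
  obtain ⟨Cg, hCg⟩ := exists_bound_comp_inner_sphere hg hn
  have hmf : Measurable fun ω : EuclideanSpace ℝ (Fin 3) => f ⟪n', ω⟫_ℝ :=
    hf.measurable.comp (measurable_const.inner measurable_id)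
  have hmg : Measurable fun ω : EuclideanSpace ℝ (Fin 3) => g ⟪n, ω⟫_ℝ :=
    hg.measurable.comp (measurable_const.inner measurable_id)
  have hS1 := integral_sphere_zonal_mul_eq_intervalIntegral hn hg.measurable hmf
    (integrable_sphere_zonal_mul hn (hg.intervalIntegrable _ _) hmf hCf)
  have hS2 := integral_sphere_zonal_mul_eq_intervalIntegral hn' hf.measurable hmg
    (integrable_sphere_zonal_mul hn' (hf.intervalIntegrable _ _) hmg hCg)
  have hcomm : ∫ ω : sphere (0 : EuclideanSpace ℝ (Fin 3)) 1, g ⟪n, (ω : EuclideanSpace ℝ (Fin 3))⟫_ℝ *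
      f ⟪n', (ω : EuclideanSpace ℝ (Fin 3))⟫_ℝ ∂sphereMeasure =
      ∫ ω : sphere (0 : EuclideanSpace ℝ (Fin 3)) 1, f ⟪n', (ω : EuclideanSpace ℝ (Fin 3))⟫_ℝ *
        g ⟪n, (ω : EuclideanSpace ℝ (Fin 3))⟫_ℝ ∂sphereMeasure :=
    integral_congr_ae (Eventually.of_forall fun ω => mul_comm _ _)
  -- heights of the circle points
  have h1 : ∀ z φ : ℝ, ⟪n', z • n + √(1 - z ^ 2) • (cos φ • Lambert.e₁ n + sin φ • Lambert.e₂ n)⟫_ℝ =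
      z * y + √(1 - z ^ 2) * √(1 - y ^ 2) * cos φ := fun z φ => by
    rw [hn'_def]
    simp only [inner_add_left, inner_add_right, inner_smul_left, inner_smul_right, real_inner_self_eq_norm_sq,
      hn, Lambert.inner_self_e₁, Lambert.inner_self_e₂, Lambert.inner_e₁_self, Lambert.norm_e₁,
      Lambert.inner_e₁_e₂, conj_trivial]
    ring
  have h2 : ∀ z φ : ℝ, ⟪n, z • n' + √(1 - z ^ 2) • (cos φ • Lambert.e₁ n' + sin φ • Lambert.e₂ n')⟫_ℝ =
      z * y + (√(1 - z ^ 2) * ⟪n, Lambert.e₁ n'⟫_ℝ * cos φ + √(1 - z ^ 2) * ⟪n, Lambert.e₂ n'⟫_ℝ * sin φ) :=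
    fun z φ => by
    simp only [inner_add_right, inner_smul_right, hnn']
    ring
  have h3 : ⟪n, Lambert.e₁ n'⟫_ℝ ^ 2 + ⟪n, Lambert.e₂ n'⟫_ℝ ^ 2 = 1 - y ^ 2 := by
    have h := (Lambert.frameBasis hn').sum_sq_inner_left n
    rw [Lambert.coe_frameBasis, Fin.sum_univ_three, hn, one_pow] at h
    simp only [Lambert.frame, Matrix.cons_val_zero, Matrix.cons_val_one, Matrix.cons_val_two,
      Matrix.head_cons, Matrix.tail_cons, hnn'] at h
    linarith
  -- assembly
  calc ∫ x in (-1:ℝ)..1, g x * ∫ φ in (-π)..π, f (x * y + √(1 - x ^ 2) * √(1 - y ^ 2) * cos φ)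
      = ∫ ω : sphere (0 : EuclideanSpace ℝ (Fin 3)) 1, g ⟪n, (ω : EuclideanSpace ℝ (Fin 3))⟫_ℝ *
          f ⟪n', (ω : EuclideanSpace ℝ (Fin 3))⟫_ℝ ∂sphereMeasure := by
        rw [hS1]; simp_rw [h1]
    _ = ∫ z in (-1:ℝ)..1, f z * ∫ φ in (-π)..π,
          g (z * y + (√(1 - z ^ 2) * ⟪n, Lambert.e₁ n'⟫_ℝ * cos φ + √(1 - z ^ 2) * ⟪n, Lambert.e₂ n'⟫_ℝ * sin φ)) := by
        rw [hcomm, hS2]; simp_rw [h2]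
    _ = _ := by
        refine intervalIntegral.integral_congr fun z hz => ?_
        rw [uIcc_of_le (by norm_num)] at hz
        have hz2 : 0 ≤ 1 - z ^ 2 := by nlinarith [hz.1, hz.2]
        rw [intervalIntegral_comp_cos_add_sin (fun s => g (z * y + s)), mul_pow, mul_pow, ← mul_add, h3,
          sq_sqrt hz2, sqrt_mul hz2]

/-! ### The product formula: circle averages of Legendre polynomials -/

/-- **Legendre's product formula** (the integrated addition theorem): for `x, y ∈ [-1, 1]` and every `ℓ`,
`∫_{-π}^{π} P_ℓ(x y + √(1-x²)√(1-y²) cos φ) dφ = 2π P_ℓ(x) P_ℓ(y)`.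
Proof without spherical harmonics: the left side is a polynomial `Q(x)` of degree `≤ ℓ`
(`exists_polynomial_circleIntegral`); by the self-adjointness of the circle average and the orthogonality
of `P_ℓ` to lower degrees, `Q ⊥ P_k` for `k < ℓ`, so `Q = c P_ℓ` (`eq_zero_of_orthogonal_legendre`); at
`x = 1` the circle degenerates and `c = Q(1) = 2π P_ℓ(y)`. [folklore] -/
theorem circleIntegral_legendre (ℓ : ℕ) {x y : ℝ} (hx : x ∈ Icc (-1:ℝ) 1) (hy : y ∈ Icc (-1:ℝ) 1) :
    ∫ φ in (-π)..π, (legendre ℓ).eval (x * y + √(1 - x ^ 2) * √(1 - y ^ 2) * cos φ) =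
      2 * π * ((legendre ℓ).eval x * (legendre ℓ).eval y) := by
  obtain ⟨Q, hQd, hQe⟩ := exists_polynomial_circleIntegral (legendre ℓ) hy
  rw [natDegree_legendre] at hQd
  -- `Q ⊥ P_k` for `k < ℓ`
  have horth : ∀ k < ℓ, ∫ t in (-1:ℝ)..1, Q.eval t * (legendre k).eval t = 0 := by
    intro k hk
    obtain ⟨Qk, hQkd, hQke⟩ := exists_polynomial_circleIntegral (legendre k) hy
    rw [natDegree_legendre] at hQkd
    calc ∫ t in (-1:ℝ)..1, Q.eval t * (legendre k).eval t
        = ∫ t in (-1:ℝ)..1, (legendre k).eval t *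
            ∫ φ in (-π)..π, (legendre ℓ).eval (t * y + √(1 - t ^ 2) * √(1 - y ^ 2) * cos φ) := by
          refine intervalIntegral.integral_congr fun t ht => ?_
          rw [uIcc_of_le (by norm_num)] at ht
          rw [hQe t ht, mul_comm]
      _ = ∫ t in (-1:ℝ)..1, (legendre ℓ).eval t *
            ∫ φ in (-π)..π, (legendre k).eval (t * y + √(1 - t ^ 2) * √(1 - y ^ 2) * cos φ) :=
          intervalIntegral_mul_circleIntegral_comm (legendre ℓ).continuous (legendre k).continuous hy
      _ = ∫ t in (-1:ℝ)..1, (legendre ℓ).eval t * Qk.eval t := by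
          refine intervalIntegral.integral_congr fun t ht => ?_
          rw [uIcc_of_le (by norm_num)] at ht
          rw [hQke t ht]
      _ = 0 := integral_legendre_mul_eq_zero
          ((degree_le_of_natDegree_le hQkd).trans_lt (by exact_mod_cast hk))
  -- hence `Q = c P_ℓ`
  set c : ℝ := (2 * ℓ + 1) / 2 * ∫ t in (-1:ℝ)..1, Q.eval t * (legendre ℓ).eval t with hc
  have hI : ∀ k : ℕ, IntervalIntegrable (fun t => Q.eval t * (legendre k).eval t) volume (-1) 1 := fun k =>
    (Q.continuous.mul (legendre k).continuous).intervalIntegrable _ _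
  have hI' : ∀ k : ℕ, IntervalIntegrable (fun t => c * ((legendre ℓ).eval t * (legendre k).eval t))
      volume (-1) 1 := fun k =>
    (continuous_const.mul ((legendre ℓ).continuous.mul (legendre k).continuous)).intervalIntegrable _ _
  have hQ : Q = C c * legendre ℓ := by
    refine sub_eq_zero.1 (eq_zero_of_orthogonal_legendre (n := ℓ) ?_ fun k hk => ?_)
    · refine (natDegree_sub_le _ _).trans (max_le hQd ((natDegree_C_mul_le _ _).trans ?_))
      rw [natDegree_legendre]
    have hsplit : ∫ t in (-1:ℝ)..1, (Q - C c * legendre ℓ).eval t * (legendre k).eval t =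
        (∫ t in (-1:ℝ)..1, Q.eval t * (legendre k).eval t) -
          c * ∫ t in (-1:ℝ)..1, (legendre ℓ).eval t * (legendre k).eval t := by
      rw [← intervalIntegral.integral_const_mul, ← intervalIntegral.integral_sub (hI k) (hI' k)]
      refine intervalIntegral.integral_congr fun t _ => ?_
      simp only [eval_sub, eval_mul, eval_C]
      ring
    rw [hsplit]
    rcases hk.lt_or_eq with hk | rfl
    · rw [horth k hk, integral_legendre_mul_legendre_eq_zero hk, mul_zero, sub_zero]
    · have hsq : ∫ t in (-1:ℝ)..1, (legendre k).eval t * (legendre k).eval t = 2 / (2 * k + 1) := by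
        rw [← integral_legendre_sq k]
        exact intervalIntegral.integral_congr fun t _ => by ring
      rw [hsq, hc]
      field_simp
      ring
  -- `c = Q(1) = 2π P_ℓ(y)`
  have hc1 : c = 2 * π * (legendre ℓ).eval y := by
    have h1 := hQe 1 ⟨by norm_num, le_rfl⟩
    rw [hQ, eval_mul, eval_C, eval_one_legendre, mul_one] at h1
    rw [← h1]
    simp only [one_pow, sub_self, sqrt_zero, zero_mul, add_zero, one_mul, intervalIntegral.integral_const,
      smul_eq_mul]
    ring
  rw [hQe x hx, hQ, eval_mul, eval_C, hc1]
  ring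

/-- **Circle averages of zonal Legendre functions** (Funk–Hecke on circles): for unit `n, n'` of `ℝ³`,
`z ∈ [-1, 1]` and every `ℓ`,
`∫_{-π}^{π} P_ℓ(⟪n', z n + √(1-z²)(cos φ e₁ n + sin φ e₂ n)⟫) dφ = 2π P_ℓ(z) P_ℓ(⟪n, n'⟫)`:
the circle average `A_z` about `n` acts on the zonal harmonic `P_ℓ(⟪n', ·⟫)` of ANY pole `n'` as the
multiplier `P_ℓ(z)`. Reduction to `circleIntegral_legendre`: `⟪n', c_z(φ)⟫ = z t + √(1-z²)(a cos φ + b sin φ)`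
with `t = ⟪n', n⟫`, `a² + b² = 1 - t²` (Parseval in the frame `(e₁ n, e₂ n, n)`), and phase invariance.
[folklore] -/
theorem circleIntegral_legendre_inner (ℓ : ℕ) {n n' : EuclideanSpace ℝ (Fin 3)} (hn : ‖n‖ = 1)
    (hn' : ‖n'‖ = 1) {z : ℝ} (hz : z ∈ Icc (-1:ℝ) 1) :
    ∫ φ in (-π)..π, (legendre ℓ).eval
        ⟪n', z • n + √(1 - z ^ 2) • (cos φ • Lambert.e₁ n + sin φ • Lambert.e₂ n)⟫_ℝ =
      2 * π * ((legendre ℓ).eval z * (legendre ℓ).eval ⟪n, n'⟫_ℝ) := by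
  have hz2 : 0 ≤ 1 - z ^ 2 := by nlinarith [hz.1, hz.2]
  have h1 : ∀ φ : ℝ, ⟪n', z • n + √(1 - z ^ 2) • (cos φ • Lambert.e₁ n + sin φ • Lambert.e₂ n)⟫_ℝ =
      z * ⟪n', n⟫_ℝ + (√(1 - z ^ 2) * ⟪n', Lambert.e₁ n⟫_ℝ * cos φ +
        √(1 - z ^ 2) * ⟪n', Lambert.e₂ n⟫_ℝ * sin φ) := fun φ => by
    simp only [inner_add_right, inner_smul_right]
    ring
  have h2 : ⟪n', Lambert.e₁ n⟫_ℝ ^ 2 + ⟪n', Lambert.e₂ n⟫_ℝ ^ 2 = 1 - ⟪n', n⟫_ℝ ^ 2 := by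
    have h := (Lambert.frameBasis hn).sum_sq_inner_left n'
    rw [Lambert.coe_frameBasis, Fin.sum_univ_three, hn', one_pow] at h
    simp only [Lambert.frame, Matrix.cons_val_zero, Matrix.cons_val_one, Matrix.cons_val_two,
      Matrix.head_cons, Matrix.tail_cons] at h
    linarith
  have ht : ⟪n', n⟫_ℝ ∈ Icc (-1:ℝ) 1 := by
    have h := abs_real_inner_le_norm n' n
    rw [hn, hn', mul_one] at h
    exact abs_le.1 h
  simp_rw [h1]
  rw [intervalIntegral_comp_cos_add_sin (fun s => (legendre ℓ).eval (z * ⟪n', n⟫_ℝ + s)), mul_pow, mul_pow,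
    ← mul_add, h2, sq_sqrt hz2, sqrt_mul hz2, circleIntegral_legendre ℓ hz ht, real_inner_comm n n']

/-- **Funk–Hecke for zonal Legendre functions**: for unit `n, n'` of `ℝ³`, a zonal weight `k` (measurable,
integrable on `[-1, 1]`) and every `ℓ`,
`∫_{S²} k(⟪n, ω⟫) P_ℓ(⟪n', ω⟫) dσ(ω) = (2π ∫_{-1}^{1} k(z) P_ℓ(z) dz) · P_ℓ(⟪n, n'⟫)` — every zonal operator
is diagonal on the zonal harmonics of degree `ℓ` (of any pole), with eigenvalue its `ℓ`-th Legendre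
coefficient `λ_ℓ(k) = 2π ∫ k P_ℓ` (Funk–Hecke for circles `integral_sphere_zonal_mul_eq_intervalIntegral` and
`circleIntegral_legendre_inner`). [folklore] -/
theorem integral_sphere_zonal_mul_legendre (ℓ : ℕ) {n n' : EuclideanSpace ℝ (Fin 3)} (hn : ‖n‖ = 1)
    (hn' : ‖n'‖ = 1) {k : ℝ → ℝ} (hk : Measurable k) (hkI : IntervalIntegrable k volume (-1) 1) :
    ∫ ω : sphere (0 : EuclideanSpace ℝ (Fin 3)) 1, k ⟪n, (ω : EuclideanSpace ℝ (Fin 3))⟫_ℝ *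
        (legendre ℓ).eval ⟪n', (ω : EuclideanSpace ℝ (Fin 3))⟫_ℝ ∂sphereMeasure =
      (2 * π * ∫ z in (-1:ℝ)..1, k z * (legendre ℓ).eval z) * (legendre ℓ).eval ⟪n, n'⟫_ℝ := by
  have hY : Measurable fun ω : EuclideanSpace ℝ (Fin 3) => (legendre ℓ).eval ⟪n', ω⟫_ℝ :=
    (legendre ℓ).continuous.measurable.comp (measurable_const.inner measurable_id)
  obtain ⟨C, hC⟩ := exists_bound_comp_inner_sphere (legendre ℓ).continuous hn'
  rw [integral_sphere_zonal_mul_eq_intervalIntegral hn hk hY (integrable_sphere_zonal_mul hn hkI hY hC),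
    ← intervalIntegral.integral_const_mul, ← intervalIntegral.integral_mul_const]
  refine intervalIntegral.integral_congr fun z hz => ?_
  rw [uIcc_of_le (by norm_num)] at hz
  rw [circleIntegral_legendre_inner ℓ hn hn' hz]
  ring

/-! ### Registered helpers -/

/-- **Registered helper `t12_circleAvg_legendre` — circle averages of zonal Legendre functions (the
product formula / Funk–Hecke on circles).** For unit vectors `n, n'` of `ℝ³`, `z ∈ [-1, 1]` and every `ℓ`:
`∫_{-π}^{π} P_ℓ(⟪n', z n + √(1-z²)(cos φ e₁ n + sin φ e₂ n)⟫) dφ = 2π P_ℓ(z) P_ℓ(⟪n, n'⟫)` — the normalised circle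
average `A_z` about `n` (FACT F of the corrector-growth plan, `…T12LorentzCircleAvg`) acts on the zonal harmonic
`P_ℓ(⟪n', ·⟫)` of ANY pole as the multiplier `P_ℓ(z)`. With FACT F this gives `A_ρ Y_ℓ = P_ℓ(ρ) Y_ℓ` on zonal
harmonics, whence the multiplier table `λ_ℓ(α) = 4∫₀¹ρ^{α+1}P_ℓ(ρ)dρ` (`…T12Indicial`) and, iterated, the Legendre
coefficients `Π_i P_ℓ(ρ_i)` of the `k`-fold far-field kernel (plan §6 FF2/FF4). Proof without spherical
harmonics: polynomial degree count, self-adjointness of the circle average (two poles of one sphere integral),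
Legendre orthogonality, evaluation at the pole (`circleIntegral_legendre`). [folklore] -/
theorem t12_circleAvg_legendre : ∀ (ℓ : ℕ) (n n' : EuclideanSpace ℝ (Fin 3)), ‖n‖ = 1 → ‖n'‖ = 1 → ∀ z : ℝ, z ∈ Set.Icc (-1 : ℝ) 1 → ∫ φ in (-Real.pi)..Real.pi, (Literature.Analysis.SpecialFunctions.legendre ℓ).eval (inner ℝ n' (z • n + Real.sqrt (1 - z ^ 2) • (Real.cos φ • Literature.Analysis.FluidPDE.Lambert.e₁ n + Real.sin φ • Literature.Analysis.FluidPDE.Lambert.e₂ n))) = 2 * Real.pi * ((Literature.Analysis.SpecialFunctions.legendre ℓ).eval z * (Literature.Analysis.SpecialFunctions.legendre ℓ).eval (inner ℝ n n')) :=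
  fun ℓ _ _ hn hn' _ hz => circleIntegral_legendre_inner ℓ hn hn' hz

/-- **Registered helper `t12_funkHecke_legendre` — the Funk–Hecke formula for Legendre polynomials on `S²`.**
For unit vectors `n, n'` of `ℝ³`, a zonal weight `k : ℝ → ℝ` (measurable, integrable on `[-1, 1]`) and every `ℓ`:
`∫_{S²} k(⟪n, ω⟫) P_ℓ(⟪n', ω⟫) dσ(ω) = (2π ∫_{-1}^{1} k(z) P_ℓ(z) dz) · P_ℓ(⟪n, n'⟫)` — every zonal operator of the
far-field calculus (one collision step `k = 2x₊ a(sx)`, the normalised step `(2/π)x₊²` on the linear-growth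
class, their iterates) is DIAGONAL on the zonal harmonics of degree `ℓ`, with eigenvalue its `ℓ`-th Legendre
coefficient `λ_ℓ(k) = 2π∫ k P_ℓ` (`|λ_ℓ| ≤ 2π‖k‖_∞‖P_ℓ‖₁`, the numbers `μ_ℓ, c_ℓ` of `…T12Legendre*`). From
Funk–Hecke for circles (`t12_funkHecke_circle`) and `t12_circleAvg_legendre`. [folklore] -/
theorem t12_funkHecke_legendre : ∀ (ℓ : ℕ) (n n' : EuclideanSpace ℝ (Fin 3)), ‖n‖ = 1 → ‖n'‖ = 1 → ∀ k : ℝ → ℝ, Measurable k → IntervalIntegrable k MeasureTheory.volume (-1) 1 → ∫ ω : Metric.sphere (0 : EuclideanSpace ℝ (Fin 3)) 1, k (inner ℝ n (ω : EuclideanSpace ℝ (Fin 3))) * (Literature.Analysis.SpecialFunctions.legendre ℓ).eval (inner ℝ n' (ω : EuclideanSpace ℝ (Fin 3))) ∂Literature.MathematicalPhysics.KineticTheory.sphereMeasure = (2 * Real.pi * ∫ z in (-1 : ℝ)..1, k z * (Literature.Analysis.SpecialFunctions.legendre ℓ).eval z) * (Literature.Analysis.SpecialFunctions.legendre ℓ).eval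 (inner ℝ n n') :=
  fun ℓ _ _ hn hn' _ hk hkI => integral_sphere_zonal_mul_legendre ℓ hn hn' hk hkI

end Summit.AtomisticToContinuum.HydrodynamicLimit.Theorems.ClampedCorrectorBirth

end
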